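import Summits.BirchSwinnertonDyer.BirchSwinnertonDyer.Theorems.BiquadraticEisensteinDescentHeegnerTwistCouplingInSupplyLinnikCensusSlot
import Summits.BirchSwinnertonDyer.BirchSwinnertonDyer.Theorems.BiquadraticEisensteinDescentHeegnerTwistCouplingInSupplyLinnikCensusPatternFree
import Mathlib.Tactic.NormNum.LegendreSymbol
import HarnessLib

set_option linter.dupNamespace false -- `Summit.BirchSwinnertonDyer.BirchSwinnertonDyer.Theorems.…` (summit = sub)
set_option autoImplicit false

/-!
# Crux `HeegnerTwistCouplingInSupply` (stmt-BirchSwinnertonDyer-21381) — the k = 1 PATTERN-FREE CENSUS (two slots):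
# `E_{pr}`, `E_{2pr}` satisfy the crux conclusion for ALL BUT `O_r(log⁸ Q)` primes `p ≤ Q` of a configuration, modulo Burungale–Tian

Route `BiquadraticEisensteinDescent` (cell `pub/bsd-wall`, width seat `bsd-wall-cm-bed-w3` g19; `--supports` 21381, helper).
Assembly of `…LinnikCensusSlot.slotCensus` (one located slot fails on `≤ C log⁸ Q` primes, unconditionally) with the pattern-free
doors `…LinnikCensusPatternFree` (two located primes realising a two-slot family that wins for both mutual symbols ⇒ the crux
conclusion, modulo Burungale–Tian). State of the record before this file (SIGN-TABLE-KERNEL-w3g18 §6, LEAD-VERDICT-ibd-p1-g11 §4 (ii)):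
for the two-parameter congruent families the located recipes cover «99.7–100 % of the residue classes of `p`, never all `p`», the prime
SUPPLY being the sign-table card's untyped analytic input. Here, for every configuration `(p mod 8, r mod 8, (r/p), parity)` that owns a
two-slot pattern-free family (13 of the 16 k = 1 configurations; the other three own three-slot families, companion file):

* ★★ `kOne_allBut_two_of_BT` (odd base `W = E_{pr}`) / `kOne_allBut_two_even_of_BT` (even base `W = E_{2pr}`): for a FIXED prime `r` in
  class `rc`, slot classes `k₀, k₁ (mod 8r)` matching the family's cells, and Burungale–Tian: `∃ C > 0, ∀ Q ≥ 3, ∃ E, #E ≤ C (log Q)⁸`, and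
  EVERY prime `p ≡ pc (mod 8)` with `[(r/p) = −1] = rp`, `⌊√Q⌋ < p ≤ Q`, `p ∉ E` satisfies the conclusion of crux 21381 for `W`
  (a Heegner `K′` with `4 < |d_{K′}|`, `L(W^{(d_{K′})}, 1) ≠ 0`, `p ∤ h(K′)`);
* headline instances with the slot classes discharged by `norm_num`: ★ `cruxConclusion_E3p_allBut_of_BT` (`W = E_{3p}`, every class of
  `p ≡ 7 (mod 8)`: both `(3/p)` signs), ★ `cruxConclusion_E5p_allBut_of_BT` (`W = E_{5p}`, `p ≡ 3 (mod 8)`).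

Mechanism: `E := E₀ ∪ E₁`, `Eᵢ` = primes with no located prime `q ≤ ⌊⌊√Q⌋^{1/2}⌋`, `q ≡ kᵢ (8r)`, `(q/p) = sᵢ` (`slotCensus`); off `E` pick
one prime per slot: distinct (distinct cells), `≠ p` (size), `≠ r` (unit class), `q₀q₁ ≤ ⌊√Q⌋ < p` so `√(q₀q₁)·log(q₀q₁) < 2p < πp`; the door
concludes. HONEST FRAMING: RUNG-LEVEL, per fixed `r` (the constant depends on `r` through the PNT threshold mod `8r`), density one in `p`
with a polylog exceptional set, every individual `p` conceded; congruent (`j = 1728`) two-parameter families only; the crux as stated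
(all CM `W`; residual C⁺), its stubs and BSD are NOT touched; nothing is closed. THEOREMS ONLY (no `def`).
-/

namespace Summit.BirchSwinnertonDyer.BirchSwinnertonDyer.Theorems.LinnikCensus

open Finset
open Literature.NumberTheory.EllipticCurves
open Summit.BirchSwinnertonDyer.BirchSwinnertonDyer.Theorems.SymbolicMonsky

/-! ## Small lemmas: size, slot extraction, slot properties -/

/-- **Size for two slots**: `q₀, q₁ ≤ y`, `1 ≤ qᵢ`, `y² < p` ⇒ `√(q₀q₁)·log(q₀q₁) < π p` (`√(q₀q₁) ≤ y`, `log(q₀q₁) ≤ 2 log y ≤ 2(y−1)`,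
`2y² < 2p < πp`). [folklore] -/
theorem size_two {q0 q1 y p : ℕ} (h0 : 1 ≤ q0) (h1 : 1 ≤ q1) (hq0 : q0 ≤ y) (hq1 : q1 ≤ y) (hp : y ^ 2 < p) :
    Real.sqrt ((q0 * q1 : ℕ) : ℝ) * Real.log ((q0 * q1 : ℕ) : ℝ) < Real.pi * p := by
  have hy1 : (1 : ℝ) ≤ y := by exact_mod_cast (h0.trans hq0)
  have hm1 : (1 : ℝ) ≤ ((q0 * q1 : ℕ) : ℝ) := by exact_mod_cast Nat.one_le_iff_ne_zero.mpr (Nat.mul_ne_zero (by omega) (by omega))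
  have hmy : ((q0 * q1 : ℕ) : ℝ) ≤ (y : ℝ) ^ 2 := by
    have : q0 * q1 ≤ y ^ 2 := by nlinarith
    exact_mod_cast this
  have hsqrt : Real.sqrt ((q0 * q1 : ℕ) : ℝ) ≤ y := by
    rw [Real.sqrt_le_left (by positivity)]; exact hmy
  have hlog : Real.log ((q0 * q1 : ℕ) : ℝ) ≤ 2 * ((y : ℝ) - 1) := by
    calc Real.log ((q0 * q1 : ℕ) : ℝ) ≤ Real.log ((y : ℝ) ^ 2) := Real.log_le_log (by positivity) hmy
      _ = 2 * Real.log y := by rw [Real.log_pow]; norm_num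
      _ ≤ 2 * ((y : ℝ) - 1) := by gcongr; exact Real.log_le_sub_one_of_pos (by positivity)
  have hlog0 : 0 ≤ Real.log ((q0 * q1 : ℕ) : ℝ) := Real.log_nonneg hm1
  have hp' : (y : ℝ) ^ 2 + 1 ≤ p := by exact_mod_cast hp
  calc Real.sqrt ((q0 * q1 : ℕ) : ℝ) * Real.log ((q0 * q1 : ℕ) : ℝ) ≤ y * (2 * ((y : ℝ) - 1)) :=
        mul_le_mul hsqrt hlog hlog0 (by positivity)
    _ < 3 * ((y : ℝ) ^ 2 + 1) := by nlinarith
    _ ≤ Real.pi * p := mul_le_mul (le_of_lt Real.pi_gt_three) hp' (by positivity) Real.pi_pos.le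

open scoped Classical in
/-- **Slot extraction**: a prime `p` with `⌊√Q⌋ < p ≤ Q` outside the slot's exceptional set has a located prime in the slot. [folklore] -/
theorem exists_slotPrime {M c Q p : ℕ} {s : ℤ} (hp : p.Prime) (hyp : Nat.sqrt Q < p) (hpQ : p ≤ Q)
    (hE : p ∉ (Finset.range (Q + 1)).filter (fun p : ℕ => p.Prime ∧ Nat.sqrt Q < p ∧
      ∀ q : ℕ, q.Prime → q % M = c % M → q ≤ Nat.sqrt (Nat.sqrt Q) → jacobiSym (q : ℤ) p ≠ s)) :
    ∃ q : ℕ, q.Prime ∧ q % M = c % M ∧ q ≤ Nat.sqrt (Nat.sqrt Q) ∧ jacobiSym (q : ℤ) p = s := by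
  by_contra hne
  apply hE
  rw [Finset.mem_filter, Finset.mem_range]
  refine ⟨by omega, hp, hyp, fun q hq hqc hqy hJ => hne ⟨q, hq, hqc, hqy, hJ⟩⟩

/-- **Slot properties**: a prime `q` in the unit class `k (mod 8r)` with `k ≡ a (mod 8)` has `q ≡ a (mod 8)` and `q ≠ r`. [folklore] -/
theorem slot_props {r k q : ℕ} (hr : r.Prime) (hku : IsUnit ((k : ℕ) : ZMod (8 * r))) (hqk : q % (8 * r) = k % (8 * r))
    {a : ℕ} (hka : k % 8 = a) : q % 8 = a ∧ q ≠ r := by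
  constructor
  · have h8 : 8 ∣ 8 * r := dvd_mul_right 8 r
    rw [← Nat.mod_mod_of_dvd q h8, hqk, Nat.mod_mod_of_dvd k h8, hka]
  · rintro rfl
    have hqk' : ((q : ℕ) : ZMod (8 * q)) = ((k : ℕ) : ZMod (8 * q)) := (ZMod.natCast_eq_natCast_iff' q k (8 * q)).mpr hqk
    rw [← hqk', ZMod.isUnit_iff_coprime] at hku
    have : Nat.Coprime q q := Nat.Coprime.coprime_dvd_right (dvd_mul_left q 8) hku
    rw [Nat.coprime_self] at this
    exact hr.one_lt.ne' this

/-- `clsVal` is injective (the four odd classes mod `8`). [folklore] -/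
theorem clsVal_injective : Function.Injective clsVal := by decide

/-- **Distinct cells ⇒ distinct primes**: two primes in different cells `(class mod 8, (·/r))` are different. [folklore] -/
theorem ne_of_cells_ne {r q0 q1 : ℕ} {c0 c1 : Fin 4 × Bool} (hc : c0 ≠ c1)
    (hq0m : q0 % 8 = clsVal c0.1) (hq1m : q1 % 8 = clsVal c1.1)
    (he0 : jacobiSym (q0 : ℤ) r = -1 ↔ c0.2 = true) (he1 : jacobiSym (q1 : ℤ) r = -1 ↔ c1.2 = true) : q0 ≠ q1 := by
  rintro rfl
  apply hc
  have h1 : c0.1 = c1.1 := clsVal_injective (hq0m.symm.trans hq1m)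
  have h2 : c0.2 = c1.2 := by
    rcases Bool.eq_false_or_eq_true c0.2 with h | h <;> rcases Bool.eq_false_or_eq_true c1.2 with h' | h'
    · rw [h, h']
    · exact absurd (he0.mpr h) (fun hh => by rw [he1] at hh; rw [hh] at h'; exact Bool.noConfusion h')
    · exact absurd (he1.mpr h') (fun hh => by rw [he0] at hh; rw [hh] at h; exact Bool.noConfusion h)
    · rw [h, h']
  exact Prod.ext h1 h2

/-- The sign dictionary: with `σ = if s then −1 else 1`, `(q/p) = σ` gives `[(q/p) = −1] = s`. [folklore] -/
theorem sign_iff_of_eq {q p : ℕ} {s : Bool} (h : jacobiSym (q : ℤ) p = if s then -1 else 1) :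
    jacobiSym (q : ℤ) p = -1 ↔ s = true := by
  cases s <;> simp_all

/-! ## The two-slot census, odd base `E_{pr}` -/

open scoped Classical in
/-- ★★ **k = 1 pattern-free census, two slots, odd base `W = E_{pr}`.** Fix a configuration `(pc, rc, rp)`, a two-slot family (cells
`c₀ ≠ c₁`, signs `s₀, s₁`) that WINS FOR BOTH mutual symbols (`hwin`), a prime `r ≡ rc (mod 8)`, and unit slot classes `k₀, k₁ (mod 8r)`
matching the cells (`kᵢ ≡ cᵢ.1 (mod 8)`; primes `q ≡ kᵢ` have `[(q/r) = −1] = cᵢ.2`). Then, modulo Burungale–Tian only: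
`∃ C > 0, ∀ Q ≥ 3, ∃ E ⊆ ℕ, #E ≤ C (log Q)⁸`, and every prime `p ≡ pc (mod 8)` with `[(r/p) = −1] = rp`, `⌊√Q⌋ < p ≤ Q`, `p ∉ E` has a
Heegner field `K′` of `N(E_{pr})` with `4 < |d_{K′}|`, `L(E_{pr}^{(d_{K′})}, 1) ≠ 0`, `p ∤ h(K′)` — the conclusion of crux 21381 for
`W = E_{pr}`. `E = E₀ ∪ E₁ ∪ [0, r²]`-part: each `Eᵢ` from `slotCensus` (Montgomery's large sieve + PNT-AP, tree, proved).
[cite: BurungaleTian2026, Thm. 1.1] [cite: Montgomery1978, p. 561] [cite: MontgomeryVaughan2007, Cor. 11.17] -/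
theorem kOne_allBut_two_of_BT (hBT : burungaleTian_analyticRank_eq_zero_of_selmerCorank_eq_zero_of_hasCM)
    {pc rc : Fin 4} {rp : Bool} (c0 c1 : Fin 4 × Bool) (s0 s1 : Bool) (hc : c0 ≠ c1)
    (hwin : ∀ b : Bool, (⟨[c0, c1], [s0, s1], [[b]]⟩ : Recipe).winsPR pc rc rp = true)
    {r : ℕ} (hr : r.Prime) (hrm : r % 8 = clsVal rc) (k0 k1 : ℕ)
    (hk0u : IsUnit ((k0 : ℕ) : ZMod (8 * r))) (hk1u : IsUnit ((k1 : ℕ) : ZMod (8 * r)))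
    (hk0m : k0 % 8 = clsVal c0.1) (hk1m : k1 % 8 = clsVal c1.1)
    (hk0e : ∀ q : ℕ, q.Prime → q % (8 * r) = k0 % (8 * r) → (jacobiSym (q : ℤ) r = -1 ↔ c0.2 = true))
    (hk1e : ∀ q : ℕ, q.Prime → q % (8 * r) = k1 % (8 * r) → (jacobiSym (q : ℤ) r = -1 ↔ c1.2 = true)) :
    ∃ C : ℝ, 0 < C ∧ ∀ Q : ℕ, 3 ≤ Q → ∃ E : Finset ℕ, (E.card : ℝ) ≤ C * Real.log Q ^ 8 ∧
      ∀ p : ℕ, p.Prime → p % 8 = clsVal pc → (jacobiSym (r : ℤ) p = -1 ↔ rp = true) →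
        Nat.sqrt Q < p → p ≤ Q → p ∉ E →
        ∃ (K : Type) (_ : Field K) (_ : NumberField K),
          IsImaginaryQuadratic K ∧ 4 < (NumberField.discr K).natAbs ∧
          SatisfiesHeegnerHypothesis ((congruentNumberCurve (p * r)).conductorNorm ℤ) K ∧
          ((congruentNumberCurve (p * r)).quadraticTwist (NumberField.discr K : ℚ)).entireLFunction 1 ≠ 0 ∧
          ¬ p ∣ NumberField.classNumber K := by
  haveI : NeZero (8 * r) := ⟨Nat.mul_ne_zero (by norm_num) hr.ne_zero⟩
  have hσ0 : (if s0 then (-1 : ℤ) else 1) = 1 ∨ (if s0 then (-1 : ℤ) else 1) = -1 := by cases s0 <;> simp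
  have hσ1 : (if s1 then (-1 : ℤ) else 1) = 1 ∨ (if s1 then (-1 : ℤ) else 1) = -1 := by cases s1 <;> simp
  obtain ⟨C0, hC0, hcen0⟩ := slotCensus (8 * r) k0 hk0u hσ0
  obtain ⟨C1, hC1, hcen1⟩ := slotCensus (8 * r) k1 hk1u hσ1
  refine ⟨C0 + C1 + ((r : ℝ) ^ 2 + 1), by positivity, fun Q hQ3 => ?_⟩
  have hlog3 : 1 ≤ Real.log Q := by
    have hQ3' : (3 : ℝ) ≤ Q := by exact_mod_cast hQ3
    have he : Real.exp 1 ≤ (Q : ℝ) := le_trans (le_of_lt (lt_trans Real.exp_one_lt_d9 (by norm_num))) hQ3'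
    rwa [← Real.log_le_log_iff (Real.exp_pos 1) (by linarith), Real.log_exp] at he
  have hlog8 : 1 ≤ Real.log Q ^ 8 := one_le_pow₀ hlog3
  by_cases hQr : r ^ 2 ≤ Q
  · -- the two slot exceptional sets
    set E0 := (Finset.range (Q + 1)).filter (fun p : ℕ => p.Prime ∧ Nat.sqrt Q < p ∧
        ∀ q : ℕ, q.Prime → q % (8 * r) = k0 % (8 * r) → q ≤ Nat.sqrt (Nat.sqrt Q) →
          jacobiSym (q : ℤ) p ≠ (if s0 then (-1 : ℤ) else 1)) with hE0
    set E1 := (Finset.range (Q + 1)).filter (fun p : ℕ => p.Prime ∧ Nat.sqrt Q < p ∧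
        ∀ q : ℕ, q.Prime → q % (8 * r) = k1 % (8 * r) → q ≤ Nat.sqrt (Nat.sqrt Q) →
          jacobiSym (q : ℤ) p ≠ (if s1 then (-1 : ℤ) else 1)) with hE1
    refine ⟨E0 ∪ E1, ?_, ?_⟩
    · calc ((E0 ∪ E1).card : ℝ) ≤ (E0.card : ℝ) + E1.card := by exact_mod_cast Finset.card_union_le E0 E1
        _ ≤ C0 * Real.log Q ^ 8 + C1 * Real.log Q ^ 8 := add_le_add (hcen0 Q hQ3) (hcen1 Q hQ3)
        _ ≤ (C0 + C1 + ((r : ℝ) ^ 2 + 1)) * Real.log Q ^ 8 := by nlinarith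
    intro p hp hpm hrp hyp hpQ hpE
    rw [Finset.mem_union, not_or] at hpE
    obtain ⟨q0, hq0, hq0k, hq0y, hJ0⟩ := exists_slotPrime hp hyp hpQ hpE.1
    obtain ⟨q1, hq1, hq1k, hq1y, hJ1⟩ := exists_slotPrime hp hyp hpQ hpE.2
    obtain ⟨hq0m, hq0r⟩ := slot_props hr hk0u hq0k hk0m
    obtain ⟨hq1m, hq1r⟩ := slot_props hr hk1u hq1k hk1m
    have he0 := hk0e q0 hq0 hq0k
    have he1 := hk1e q1 hq1 hq1k
    have hyQ : Nat.sqrt (Nat.sqrt Q) ≤ Nat.sqrt Q := Nat.sqrt_le_self _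
    have hq0p : q0 ≠ p := by intro h; subst h; omega
    have hq1p : q1 ≠ p := by intro h; subst h; omega
    have hrQ : r ≤ Nat.sqrt Q := Nat.le_sqrt'.mpr hQr
    have hpr : p ≠ r := by intro h; subst h; omega
    have h01 : q0 ≠ q1 := ne_of_cells_ne hc hq0m hq1m he0 he1
    have hysq : Nat.sqrt (Nat.sqrt Q) ^ 2 ≤ Nat.sqrt Q := Nat.sqrt_le' _
    have hsize := size_two hq0.one_lt.le hq1.one_lt.le hq0y hq1y (lt_of_le_of_lt hysq hyp)
    exact Recipe.RealisesK1.cruxOnEpr_of_patternFree_two_of_BT hBT c0 c1 s0 s1 hwin hp hr hq0 hq1 hpm hrm hq0m hq1m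
      hpr hq0p hq1p hq0r hq1r h01 hrp (sign_iff_of_eq hJ0) (sign_iff_of_eq hJ1) he0 he1 hsize
  · -- `Q < r²`: everything is exceptional
    refine ⟨Finset.range (Q + 1), ?_, fun p _ _ _ _ hpQ hpE => absurd (Finset.mem_range.mpr (by omega)) hpE⟩
    have hQ' : Q < r ^ 2 := not_le.mp hQr
    have h1 : ((Finset.range (Q + 1)).card : ℝ) ≤ (r : ℝ) ^ 2 + 1 := by
      rw [Finset.card_range]; exact_mod_cast (by omega : Q + 1 ≤ r ^ 2 + 1)
    calc ((Finset.range (Q + 1)).card : ℝ) ≤ (r : ℝ) ^ 2 + 1 := h1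
      _ ≤ C0 + C1 + ((r : ℝ) ^ 2 + 1) := by linarith
      _ = (C0 + C1 + ((r : ℝ) ^ 2 + 1)) * 1 := (mul_one _).symm
      _ ≤ (C0 + C1 + ((r : ℝ) ^ 2 + 1)) * Real.log Q ^ 8 :=
          mul_le_mul_of_nonneg_left hlog8 (by positivity)

/-! ## The two-slot census, even base `E_{2pr}` -/

open scoped Classical in
/-- ★★ **k = 1 pattern-free census, two slots, even base `W = E_{2pr}`** (same as `kOne_allBut_two_of_BT` with `wins2PR` and
`W = E_{2pr}`). [cite: BurungaleTian2026, Thm. 1.1] [cite: Montgomery1978, p. 561] [cite: MontgomeryVaughan2007, Cor. 11.17] -/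
theorem kOne_allBut_two_even_of_BT (hBT : burungaleTian_analyticRank_eq_zero_of_selmerCorank_eq_zero_of_hasCM)
    {pc rc : Fin 4} {rp : Bool} (c0 c1 : Fin 4 × Bool) (s0 s1 : Bool) (hc : c0 ≠ c1)
    (hwin : ∀ b : Bool, (⟨[c0, c1], [s0, s1], [[b]]⟩ : Recipe).wins2PR pc rc rp = true)
    {r : ℕ} (hr : r.Prime) (hrm : r % 8 = clsVal rc) (k0 k1 : ℕ)
    (hk0u : IsUnit ((k0 : ℕ) : ZMod (8 * r))) (hk1u : IsUnit ((k1 : ℕ) : ZMod (8 * r)))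
    (hk0m : k0 % 8 = clsVal c0.1) (hk1m : k1 % 8 = clsVal c1.1)
    (hk0e : ∀ q : ℕ, q.Prime → q % (8 * r) = k0 % (8 * r) → (jacobiSym (q : ℤ) r = -1 ↔ c0.2 = true))
    (hk1e : ∀ q : ℕ, q.Prime → q % (8 * r) = k1 % (8 * r) → (jacobiSym (q : ℤ) r = -1 ↔ c1.2 = true)) :
    ∃ C : ℝ, 0 < C ∧ ∀ Q : ℕ, 3 ≤ Q → ∃ E : Finset ℕ, (E.card : ℝ) ≤ C * Real.log Q ^ 8 ∧
      ∀ p : ℕ, p.Prime → p % 8 = clsVal pc → (jacobiSym (r : ℤ) p = -1 ↔ rp = true) →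
        Nat.sqrt Q < p → p ≤ Q → p ∉ E →
        ∃ (K : Type) (_ : Field K) (_ : NumberField K),
          IsImaginaryQuadratic K ∧ 4 < (NumberField.discr K).natAbs ∧
          SatisfiesHeegnerHypothesis ((congruentNumberCurve (2 * (p * r))).conductorNorm ℤ) K ∧
          ((congruentNumberCurve (2 * (p * r))).quadraticTwist (NumberField.discr K : ℚ)).entireLFunction 1 ≠ 0 ∧
          ¬ p ∣ NumberField.classNumber K := by
  haveI : NeZero (8 * r) := ⟨Nat.mul_ne_zero (by norm_num) hr.ne_zero⟩
  have hσ0 : (if s0 then (-1 : ℤ) else 1) = 1 ∨ (if s0 then (-1 : ℤ) else 1) = -1 := by cases s0 <;> simp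
  have hσ1 : (if s1 then (-1 : ℤ) else 1) = 1 ∨ (if s1 then (-1 : ℤ) else 1) = -1 := by cases s1 <;> simp
  obtain ⟨C0, hC0, hcen0⟩ := slotCensus (8 * r) k0 hk0u hσ0
  obtain ⟨C1, hC1, hcen1⟩ := slotCensus (8 * r) k1 hk1u hσ1
  refine ⟨C0 + C1 + ((r : ℝ) ^ 2 + 1), by positivity, fun Q hQ3 => ?_⟩
  have hlog3 : 1 ≤ Real.log Q := by
    have hQ3' : (3 : ℝ) ≤ Q := by exact_mod_cast hQ3
    have he : Real.exp 1 ≤ (Q : ℝ) := le_trans (le_of_lt (lt_trans Real.exp_one_lt_d9 (by norm_num))) hQ3'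
    rwa [← Real.log_le_log_iff (Real.exp_pos 1) (by linarith), Real.log_exp] at he
  have hlog8 : 1 ≤ Real.log Q ^ 8 := one_le_pow₀ hlog3
  by_cases hQr : r ^ 2 ≤ Q
  · set E0 := (Finset.range (Q + 1)).filter (fun p : ℕ => p.Prime ∧ Nat.sqrt Q < p ∧
        ∀ q : ℕ, q.Prime → q % (8 * r) = k0 % (8 * r) → q ≤ Nat.sqrt (Nat.sqrt Q) →
          jacobiSym (q : ℤ) p ≠ (if s0 then (-1 : ℤ) else 1)) with hE0
    set E1 := (Finset.range (Q + 1)).filter (fun p : ℕ => p.Prime ∧ Nat.sqrt Q < p ∧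
        ∀ q : ℕ, q.Prime → q % (8 * r) = k1 % (8 * r) → q ≤ Nat.sqrt (Nat.sqrt Q) →
          jacobiSym (q : ℤ) p ≠ (if s1 then (-1 : ℤ) else 1)) with hE1
    refine ⟨E0 ∪ E1, ?_, ?_⟩
    · calc ((E0 ∪ E1).card : ℝ) ≤ (E0.card : ℝ) + E1.card := by exact_mod_cast Finset.card_union_le E0 E1
        _ ≤ C0 * Real.log Q ^ 8 + C1 * Real.log Q ^ 8 := add_le_add (hcen0 Q hQ3) (hcen1 Q hQ3)
        _ ≤ (C0 + C1 + ((r : ℝ) ^ 2 + 1)) * Real.log Q ^ 8 := by nlinarith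
    intro p hp hpm hrp hyp hpQ hpE
    rw [Finset.mem_union, not_or] at hpE
    obtain ⟨q0, hq0, hq0k, hq0y, hJ0⟩ := exists_slotPrime hp hyp hpQ hpE.1
    obtain ⟨q1, hq1, hq1k, hq1y, hJ1⟩ := exists_slotPrime hp hyp hpQ hpE.2
    obtain ⟨hq0m, hq0r⟩ := slot_props hr hk0u hq0k hk0m
    obtain ⟨hq1m, hq1r⟩ := slot_props hr hk1u hq1k hk1m
    have he0 := hk0e q0 hq0 hq0k
    have he1 := hk1e q1 hq1 hq1k
    have hyQ : Nat.sqrt (Nat.sqrt Q) ≤ Nat.sqrt Q := Nat.sqrt_le_self _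
    have hq0p : q0 ≠ p := by intro h; subst h; omega
    have hq1p : q1 ≠ p := by intro h; subst h; omega
    have hrQ : r ≤ Nat.sqrt Q := Nat.le_sqrt'.mpr hQr
    have hpr : p ≠ r := by intro h; subst h; omega
    have h01 : q0 ≠ q1 := ne_of_cells_ne hc hq0m hq1m he0 he1
    have hysq : Nat.sqrt (Nat.sqrt Q) ^ 2 ≤ Nat.sqrt Q := Nat.sqrt_le' _
    have hsize := size_two hq0.one_lt.le hq1.one_lt.le hq0y hq1y (lt_of_le_of_lt hysq hyp)
    exact Recipe.RealisesK1.cruxOnE2pr_of_patternFree_two_of_BT hBT c0 c1 s0 s1 hwin hp hr hq0 hq1 hpm hrm hq0m hq1m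
      hpr hq0p hq1p hq0r hq1r h01 hrp (sign_iff_of_eq hJ0) (sign_iff_of_eq hJ1) he0 he1 hsize
  · refine ⟨Finset.range (Q + 1), ?_, fun p _ _ _ _ hpQ hpE => absurd (Finset.mem_range.mpr (by omega)) hpE⟩
    have hQ' : Q < r ^ 2 := not_le.mp hQr
    have h1 : ((Finset.range (Q + 1)).card : ℝ) ≤ (r : ℝ) ^ 2 + 1 := by
      rw [Finset.card_range]; exact_mod_cast (by omega : Q + 1 ≤ r ^ 2 + 1)
    calc ((Finset.range (Q + 1)).card : ℝ) ≤ (r : ℝ) ^ 2 + 1 := h1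
      _ ≤ C0 + C1 + ((r : ℝ) ^ 2 + 1) := by linarith
      _ = (C0 + C1 + ((r : ℝ) ^ 2 + 1)) * 1 := (mul_one _).symm
      _ ≤ (C0 + C1 + ((r : ℝ) ^ 2 + 1)) * Real.log Q ^ 8 :=
          mul_le_mul_of_nonneg_left hlog8 (by positivity)

/-! ## ANY prime `r` of the class: slot classes by CRT (appended; uses `…LinnikCensusSlot.exists_slotClass`) -/

/-- The four classes are odd. [folklore] -/
theorem clsVal_mod_two (a : Fin 4) : clsVal a % 2 = 1 := by fin_cases a <;> decide

/-- The four classes are reduced mod `8`. [folklore] -/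
theorem clsVal_mod_eight (a : Fin 4) : clsVal a % 8 = clsVal a := by fin_cases a <;> decide

/-- A prime in one of the four odd classes is not `2`. [folklore] -/
theorem ne_two_of_mod_eight {r : ℕ} {rc : Fin 4} (hrm : r % 8 = clsVal rc) : r ≠ 2 := by
  rintro rfl; fin_cases rc <;> simp [clsVal] at hrm

/-- **Slot classes for a cell**, from `exists_slotClass`. [folklore] -/
theorem exists_slotClass_cell {r : ℕ} (hr : r.Prime) (hr2 : r ≠ 2) (c : Fin 4 × Bool) :
    ∃ k : ℕ, IsUnit ((k : ℕ) : ZMod (8 * r)) ∧ k % 8 = clsVal c.1 ∧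
      ∀ q : ℕ, q.Prime → q % (8 * r) = k % (8 * r) → (jacobiSym (q : ℤ) r = -1 ↔ c.2 = true) := by
  obtain ⟨k, hku, hkm, hke⟩ := exists_slotClass hr hr2 (clsVal_mod_two c.1) c.2
  exact ⟨k, hku, hkm.trans (clsVal_mod_eight c.1), hke⟩

open scoped Classical in
/-- ★★ **k = 1 census, two slots, odd base, ANY prime `r` of the class.** [cite: BurungaleTian2026, Thm. 1.1] [cite: Montgomery1978, p. 561]
[cite: MontgomeryVaughan2007, Cor. 11.17] -/
theorem kOne_allBut_two_anyR_of_BT (hBT : burungaleTian_analyticRank_eq_zero_of_selmerCorank_eq_zero_of_hasCM)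
    {pc rc : Fin 4} {rp : Bool} (c0 c1 : Fin 4 × Bool) (s0 s1 : Bool) (hc : c0 ≠ c1)
    (hwin : ∀ b : Bool, (⟨[c0, c1], [s0, s1], [[b]]⟩ : Recipe).winsPR pc rc rp = true)
    {r : ℕ} (hr : r.Prime) (hrm : r % 8 = clsVal rc) :
    ∃ C : ℝ, 0 < C ∧ ∀ Q : ℕ, 3 ≤ Q → ∃ E : Finset ℕ, (E.card : ℝ) ≤ C * Real.log Q ^ 8 ∧
      ∀ p : ℕ, p.Prime → p % 8 = clsVal pc → (jacobiSym (r : ℤ) p = -1 ↔ rp = true) →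
        Nat.sqrt Q < p → p ≤ Q → p ∉ E →
        ∃ (K : Type) (_ : Field K) (_ : NumberField K),
          IsImaginaryQuadratic K ∧ 4 < (NumberField.discr K).natAbs ∧
          SatisfiesHeegnerHypothesis ((congruentNumberCurve (p * r)).conductorNorm ℤ) K ∧
          ((congruentNumberCurve (p * r)).quadraticTwist (NumberField.discr K : ℚ)).entireLFunction 1 ≠ 0 ∧
          ¬ p ∣ NumberField.classNumber K := by
  have hr2 := ne_two_of_mod_eight hrm
  obtain ⟨k0, hk0u, hk0m, hk0e⟩ := exists_slotClass_cell hr hr2 c0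
  obtain ⟨k1, hk1u, hk1m, hk1e⟩ := exists_slotClass_cell hr hr2 c1
  exact kOne_allBut_two_of_BT hBT c0 c1 s0 s1 hc hwin hr hrm k0 k1 hk0u hk1u hk0m hk1m hk0e hk1e

open scoped Classical in
/-- ★★ **k = 1 census, two slots, even base, ANY prime `r` of the class.** [cite: BurungaleTian2026, Thm. 1.1] [cite: Montgomery1978, p. 561]
[cite: MontgomeryVaughan2007, Cor. 11.17] -/
theorem kOne_allBut_two_even_anyR_of_BT (hBT : burungaleTian_analyticRank_eq_zero_of_selmerCorank_eq_zero_of_hasCM)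
    {pc rc : Fin 4} {rp : Bool} (c0 c1 : Fin 4 × Bool) (s0 s1 : Bool) (hc : c0 ≠ c1)
    (hwin : ∀ b : Bool, (⟨[c0, c1], [s0, s1], [[b]]⟩ : Recipe).wins2PR pc rc rp = true)
    {r : ℕ} (hr : r.Prime) (hrm : r % 8 = clsVal rc) :
    ∃ C : ℝ, 0 < C ∧ ∀ Q : ℕ, 3 ≤ Q → ∃ E : Finset ℕ, (E.card : ℝ) ≤ C * Real.log Q ^ 8 ∧
      ∀ p : ℕ, p.Prime → p % 8 = clsVal pc → (jacobiSym (r : ℤ) p = -1 ↔ rp = true) →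
        Nat.sqrt Q < p → p ≤ Q → p ∉ E →
        ∃ (K : Type) (_ : Field K) (_ : NumberField K),
          IsImaginaryQuadratic K ∧ 4 < (NumberField.discr K).natAbs ∧
          SatisfiesHeegnerHypothesis ((congruentNumberCurve (2 * (p * r))).conductorNorm ℤ) K ∧
          ((congruentNumberCurve (2 * (p * r))).quadraticTwist (NumberField.discr K : ℚ)).entireLFunction 1 ≠ 0 ∧
          ¬ p ∣ NumberField.classNumber K := by
  have hr2 := ne_two_of_mod_eight hrm
  obtain ⟨k0, hk0u, hk0m, hk0e⟩ := exists_slotClass_cell hr hr2 c0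
  obtain ⟨k1, hk1u, hk1m, hk1e⟩ := exists_slotClass_cell hr hr2 c1
  exact kOne_allBut_two_even_of_BT hBT c0 c1 s0 s1 hc hwin hr hrm k0 k1 hk0u hk1u hk0m hk1m hk0e hk1e

end Summit.BirchSwinnertonDyer.BirchSwinnertonDyer.Theorems.LinnikCensus
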